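import Summits.Ventures.YMGap.RobustBall.CentreBlindZ2Domination
import Summits.Ventures.YMGap.RobustBall.TimesliceCorrelatorDecay
import Summits.Ventures.YMGap.RobustBall.ThermodynamicVariance
import Summits.Ventures.YMGap.RobustBall.ErgodicAverages
import Summits.Ventures.YMGap.Thresholds.HaarFourthMoment
import Summits.Ventures.YMGap.Thresholds.ZeroCouplingResampling
import Summits.Ventures.YMGap.Thresholds.HaarThirdMomentSU3
import HarnessLib

/-!
# Venture statement — YMGap (cell `pub-ymgap`) — CONJUNCT BODIES T72, T73 (= T73a–f), T74 (= T74a–c) (V23D, block 1)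

STATUS: FILED by p3 g10 as V23D = T72 + T73 (= T73a–f) + T74 (= T74a–c) on the lead's ★ R324 V23D BOOKING (lead g11 = chair, bus 2026-08-24T16:46:20Z, INBOX l.6110,
quoted verbatim: «V23D BOOKING = YES as staged (p3 ask l.6109; R319/R322 precedent): `Summits/Ventures/YMGap/StatementConjunctsV23D.lean` = T72
`T72_CentreBlindZ2Domination` (ds-4 g12 text 324e6765a6596910 …) + T73a_MassiveTimesliceDecay · T73b_SU2WilsonTimesliceDecay · T73c_ThermodynamicVariance ·
T73d_SU2VarianceDensityIsSusceptibility · T73e_ErgodicCubeAverages · T73f_SU2AlmostSureSelfAveraging + `T73_TimesliceDecayAndFluctuations` (ds-3 g14 part B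
9365511bdba22e8f …) + T74a_SU2HaarFourthMoment · T74b_SU3HaarBaryon · T74c_PlaquettesShareOneLink + `T74_HaarMomentsAndPlaquetteLinks` (ds-1 g11 block A ce7d0e3678902248
…) … (4) T65c (`CentreBlindBallWindow` d00382a6cee91066) joins the first section iff its olean is in the hub store before that FINAL-SHA line, else it rides the next
block»; R324 (3) amended l.6139: the 17:45Z floor lifted after all three owner consents). Owner consents: ds-4 (g12) NO-OBJECTION bus l.6113 (16:48Z; also T65c), ds-3
(g14) NO-OBJECTION l.6126 (16:53Z), ds-1 (g11) NO-OBJECTION l.6134 (16:56Z). At the final-sha line (17:24Z 2026-08-24) `RobustBall/CentreBlindBallWindow` (ds-4 p381975,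
tree bytes d00382a6cee91066 since 15:44Z) still had NO olean in the hub store, so T65c rides the next block per R324 (4). Numbers T72–T74 assigned by p3 under lead g10's
delegation (bus 2026-08-24T09:03:51Z «T-numbers (T71+) are p3's to assign»; ★ R322 (4) «next free number T72 (p3's)») in GREEN order = order of the owners' READY lines,
announced on the bus before filing. GREEN = parents are TREE modules with built oleans and the owner file answers a by-import `lean check` rc 0 / 0 warnings / std axioms
(all three: 2026-08-24T16:42Z). Texts, VERBATIM from the owner files: ds-4 g12 `HOME/ds/ds4/lean/sub/V24ConjunctDS4g12a.lean` 324e6765a6596910 (T72; parent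
`RobustBall/CentreBlindZ2Domination` 27660b8a167f; owner countersign in the file header, bus l.5764), ds-3 g14 `HOME/ds/ds3/lean/g14/texts/V1XConjunctsDS3g14B.lean`
9365511bdba22e8f (T73a–f; parents `RobustBall/TimesliceCorrelatorDecay` 9e0e43ecc628, `ThermodynamicVariance` da48732fdba3, `ErgodicAverages` 176c7487b780; owner line bus
l.5960 «READY … bytes frozen») and ds-1 g11 `HOME/ds/ds1g11/lean/V1X-CONJUNCTS-ds1g11-A.lean` ce7d0e3678902248 (T74a–c; parents `Thresholds/HaarFourthMoment`
e015c7963550, `ZeroCouplingResampling`, `HaarThirdMomentSU3` 170d948444dd; owner line bus l.6026). Only decl names change (map `RENAMES-V23D.txt`: owner `T_<X>` ↦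
`T72_<X>` / `T73x_<X>` / `T74x_<X>`; T72 is one text with a top-level number; the consolidating conjunctions `T73_TimesliceDecayAndFluctuations`,
`T74_HaarMomentsAndPlaquetteLinks` are p3's additions in the V20B/V22/V23 style, not owner bytes); built mechanically by `mkmono23d.py` (= the V23 builder with the group
section renamed); byte-compare `bytecmp.py --map` = verbatim-modulo-map. NOT IN THIS BLOCK (parents not yet tree modules or oleans not yet built at the final-sha line;
numbers T75+ are p3's, T65c and T67–T68a keep the lead's numbers): T65c (ds-4 g10 centre-blind ball text; `RobustBall/CentreBlindBallWindow` olean), ds-3 g14 parts A /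
C–F, ds-1 g11 B, ds-1 g10 C3/C4, ds-4 g11/g12 b–d, rb-p2 g8–g11 texts, rb-p1 g7/g8 `T_O`–`T_Z` — they open the next block at their GREEN (R294 numbered-PENDING
discipline).

HONEST FRAMING. WHAT THIS IS: bodies `Tk_… : Prop` + witnesses `Tk_…_holds`, kernel-checked with NO hypothesis, closing by TREE constants only. STRONG-COUPLING /
EXACT LATTICE statements. (T72) MACK–PETKOVA DOMINATION for the whole `SU(2)` linkwise centre-blind class: on every torus `(ℤ/L)^d`, at every tree coupling, for
EVERY linkwise centre-blind perturbation and every rectangle, `|⟨½ tr U_{∂R×T}⟩| ≤` the Wilson loop of `ℤ₂` lattice gauge theory at `β_W = 2|β|` on the same links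
(a `[0,1]`-valued bound monotone in `β_W`) — a comparison inequality, not an area law. (T73) ZERO-MOMENTUM (TIMESLICE) DECAY of truncated correlators in every
MASSIVE state on `ℤ⁴` and, with an explicit rate, for `SU(2)` at `0 ≤ β_W ≤ 1/12`; the THERMODYNAMIC VARIANCE DENSITY of cube sums equals the susceptibility
(generic for translation-invariant states with summable covariances; `SU(2)` on `|β_W| ≤ 9/25`); the almost-sure ERGODIC theorem along cubes and almost-sure
self-averaging in the unique `SU(2)` state — second-moment / ergodic statements, not a CLT, not a transfer-matrix spectral gap. (T74) COMPACT-GROUP INTEGRALS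
and lattice combinatorics: `∫_{SU(2)} (Re tr U)⁴ = 2`, `∫ (½ Re tr U)⁴ = 1/8`, `∫ (Re tr U)³ = 0`; `∫_{SU(3)} U₀₀U₁₁U₂₂ = 1/6`; two distinct plaquettes of `ℤ^d`
share at most one link and a plaquette outside a set of ≤ 3 plaquettes has a private link. Every window is where a one-link / Dobrushin bound closes (door
artefacts). WHAT THIS IS NOT: nothing at the crossover couplings, no continuum limit, no physical-units mass gap, nothing about the Yang–Mills Millennium problem.
-/

noncomputable section

namespace Summit.Ventures.YMGap

/-! ### OWNER FILE `owners/V24ConjunctDS4g12a.lean` (sha16 324e6765a6596910) — section `V23D_ds4_Z2Domination` -/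
section V23D_ds4_Z2Domination

/-!
Statement v1.x candidate conjunct from ds-4's gen-12 file `RobustBall/CentreBlindZ2Domination.lean` (TEXT for the p3 pre-stage; number / name are
p3's / the lead's; checkable against the tree once that file (p379406) is IN THE TREE with commit; NOT proposed by ds-4).  ONE conjunct:
`T72_CentreBlindZ2Domination`.  Y2 ROBUST-BALL §6(c): MACK–PETKOVA DOMINATION FOR THE WHOLE LINKWISE CENTRE-BLIND CLASS (`SU(2)`): on every torus
`(ℤ/L)^d`, at every tree coupling `β` (`β_W = 2|β|`), for EVERY linkwise centre-blind perturbation `W` (no smallness / range / window) and EVERY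
rectangle `R × T` (wrapping or not), `|⟨(1/2)tr U_{∂R×T}⟩_{β,W,L}| ≤ z2Loop (2|β|) x i j R T` = the Wilson loop `⟨σ_{∂R×T}⟩` of ℤ₂ (Ising) lattice gauge
theory `ν ∝ exp(β_W ∑_p σ_{∂p})` on the links of the same torus; the bound lies in `[0, 1]` and is monotone in `β_W`.  MECHANISM: centre projection
(Fröhlich 1979 / Mack–Petkova 1979, tree `abs_expectation_wilsonLoop_le_of_isTwistBlind`) + Griffiths' comparison for the induced inhomogeneous ℤ₂
gauge theory written as a Friedli–Velenik spin system on the links.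
OWNER COUNTERSIGN (ds-4 g12): these bytes are the text of record from this seat; p3 may rename / renumber / fold, bodies unchanged.
-/


section TZ2DominationSec

open Summit.Ventures.YMGap.RobustBall
open Literature.MathematicalPhysics.QuantumLattice (fundamentalRep)
open Literature.MathematicalPhysics.QuantumFieldTheory

/-- **T72_CentreBlindZ2Domination — track Y2 (seat ds-4 g12): MACK–PETKOVA DOMINATION FOR THE CENTRE-BLIND CLASS** (`SU(2)`): (i) for every `d`, `L`,
tree coupling `β`, every LINKWISE CENTRE-BLIND perturbation `W` of the Wilson action on `(ℤ/L)^d`, every base point `x`, directions `i, j` and every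
`R, T`, `|⟨(1/2)tr U_{∂R×T}⟩_{β,W,L}| ≤ ZTwo.z2Loop (2|β|) x i j R T`, the Wilson loop of ℤ₂ lattice gauge theory on the same torus at `β_W = 2|β|`
(`RobustBall.ZTwo.su2_abs_wilsonLoop_le_z2Loop_of_isCentreBlind`); (ii) the same for every TWIST-BLIND `W` (`…su2_abs_wilsonLoop_le_z2Loop`);
(iii) `0 ≤ z2Loop βW ≤ 1` for `βW ≥ 0` (Griffiths I; `z2Loop_nonneg`, `z2Loop_le_one`); (iv) `|βW′| ≤ βW → z2Loop βW′ ≤ z2Loop βW` (Griffiths II;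
`z2Loop_mono`).  READING: the confinement question for the class at `β` is dominated by that of ℤ₂ lattice gauge theory at `β_W`; every torus bound on
the latter transfers (the tree's rungs 1–∞ are such bounds).  HONEST LABEL: `SU(2)` only; inequalities between finite-torus expectations; no area law
asserted here; nothing continuum / spectral / Clay.  Texts: seat ds-4 (g12). -/
def T72_CentreBlindZ2Domination : Prop :=
  (∀ (d L : ℕ) [NeZero L] (β : ℝ) (W : Perturbation d L 2), IsCentreBlind W → ∀ (x : Site d L) (i j : Fin d) (R T : ℕ),
    |W.expectation (fundamentalRep (Fin 2)) β (wilsonLoop (fundamentalRep (Fin 2)) x i j R T)| ≤ ZTwo.z2Loop (2 * |β|) x i j R T) ∧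
  (∀ (d L : ℕ) [NeZero L] (β : ℝ) (W : Perturbation d L 2), IsTwistBlind W → ∀ (x : Site d L) (i j : Fin d) (R T : ℕ),
    |W.expectation (fundamentalRep (Fin 2)) β (wilsonLoop (fundamentalRep (Fin 2)) x i j R T)| ≤ ZTwo.z2Loop (2 * |β|) x i j R T) ∧
  (∀ (d L : ℕ) [NeZero L] (βW : ℝ), 0 ≤ βW → ∀ (x : Site d L) (i j : Fin d) (R T : ℕ),
    0 ≤ ZTwo.z2Loop βW x i j R T ∧ ZTwo.z2Loop βW x i j R T ≤ 1) ∧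
  (∀ (d L : ℕ) [NeZero L] (βW βW' : ℝ), |βW'| ≤ βW → ∀ (x : Site d L) (i j : Fin d) (R T : ℕ),
    ZTwo.z2Loop βW' x i j R T ≤ ZTwo.z2Loop βW x i j R T)

/-- T72_CentreBlindZ2Domination holds (`RobustBall.ZTwo.su2_abs_wilsonLoop_le_z2Loop_of_isCentreBlind`, `…su2_abs_wilsonLoop_le_z2Loop`, `…z2Loop_nonneg`,
`…z2Loop_le_one`, `…z2Loop_mono`; seat ds-4 g12 text). -/
theorem T72_CentreBlindZ2Domination_holds : T72_CentreBlindZ2Domination :=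
  ⟨fun _ _ _ β W hW x i j R T => ZTwo.su2_abs_wilsonLoop_le_z2Loop_of_isCentreBlind W hW β x i j R T,
    fun _ _ _ β W hW x i j R T => ZTwo.su2_abs_wilsonLoop_le_z2Loop W hW β x i j R T,
    fun _ _ _ _ hβ x i j R T => ⟨ZTwo.z2Loop_nonneg hβ x i j R T, ZTwo.z2Loop_le_one _ x i j R T⟩,
    fun _ _ _ _ _ h x i j R T => ZTwo.z2Loop_mono h x i j R T⟩

end TZ2DominationSec

end V23D_ds4_Z2Domination

/-! ### OWNER FILE `owners/V1XConjunctsDS3g14B.lean` (sha16 9365511bdba22e8f) — section `V23D_ds3_TimesliceVariance` -/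
section V23D_ds3_TimesliceVariance

/-!
Statement v1.x candidate conjuncts from ds-3's gen-14 files, PART B (TEXT for the p2/p3 seats; checkable once
`TimesliceCorrelatorDecay.lean` (p380921 9e0e43ecc628), `ThermodynamicVariance.lean` (p381100 da48732fdba3) and
`ErgodicAverages.lean` (p381278 176c7487b780) have their oleans BUILT; NOT proposed by ds-3). Y2 ROBUST-BALL, currencies
C-TSLICE (zero-momentum correlator decay of every massive state), C-TVAR (thermodynamic variance density = susceptibility),
C-ERG (almost-sure ergodic theorem along cubes). HONEST LABEL: lattice statements; infinite-volume DLR states; second-moment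
route; not a CLT, not a transfer-matrix spectral statement; nothing continuum, nothing at the Y3 couplings.
-/

open MeasureTheory Filter Topology ProbabilityTheory
open scoped NNReal
open Literature.Probability.LatticeModels hiding configShift configShift_apply
open Literature.MathematicalPhysics.QuantumLattice (fundamentalRep ZdEdge LGConfig ymGibbsMeasures configShift IsZdTranslationInvariant
  IsZdGaugeInvariant)
open Literature.Barriers.QuantumFields (IsMassiveState)
open Summit.Ventures.YMGap
open Summit.Ventures.YMGap.RobustBall

/-- **T73a_MassiveTimesliceDecay — EVERY MASSIVE STATE ON `ℤ⁴`**: for a state `μ` with `IsMassiveState μ` there is `m > 0` such that for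
all bounded measurable gauge-invariant local observables `F₁, F₂`, every direction `i` and every `0 < θ < 1` there is `A ≥ 0` with, for
all `t ∈ ℤ`: the timeslice-summed truncated correlator converges absolutely and `|Σ_{x : x_i = t} cov_μ(F₁, F₂∘θ_x)| ≤ A e^{−(1−θ) m |t|}`
(`RobustBall.timeslice_correlator_decay_of_isMassiveState`). -/
def T73a_MassiveTimesliceDecay : Prop :=
  ∀ (G : Type) [Group G] [MeasurableSpace G] (μ : Measure (LGConfig 4 G)), IsMassiveState μ →
    ∃ m : ℝ, 0 < m ∧ ∀ (F₁ F₂ : LGConfig 4 G → ℝ),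
      Literature.MathematicalPhysics.QuantumLattice.IsLocalObservable F₁ →
      Literature.MathematicalPhysics.QuantumLattice.IsLocalObservable F₂ →
      Measurable F₁ → Measurable F₂ → (∃ C, ∀ U, |F₁ U| ≤ C) → (∃ C, ∀ U, |F₂ U| ≤ C) →
      IsZdGaugeInvariant F₁ → IsZdGaugeInvariant F₂ → ∀ θ : ℝ, 0 < θ → θ < 1 →
      ∃ A : ℝ, 0 ≤ A ∧ ∀ (i : Fin 4) (t : ℤ),
        Summable (fun x : {x : Site 4 // x i = t} => |cov[F₁, fun U => F₂ (configShift (x : Site 4) U); μ]|) ∧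
        |∑' x : {x : Site 4 // x i = t}, cov[F₁, fun U => F₂ (configShift (x : Site 4) U); μ]| ≤
          A * Real.exp (-((1 - θ) * m) * |t|)

/-- T73a_MassiveTimesliceDecay holds. -/
theorem T73a_MassiveTimesliceDecay_holds : T73a_MassiveTimesliceDecay :=
  fun _ _ _ _ hμ => timeslice_correlator_decay_of_isMassiveState hμ

/-- **T73b_SU2WilsonTimesliceDecay — `SU(2)` ON `ℤ⁴`, `0 ≤ β_W ≤ 1/12`, EXPLICIT RATE** (tree coupling `β_W/2`): for EVERY DLR state `μ`,
all bounded measurable local `F₁, F₂`, every direction `i` and every `0 < θ < 1`: `∃ A ≥ 0, ∀ t ∈ ℤ`,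
`|Σ_{x : x_i = t} cov_μ(F₁, F₂∘θ_x)| ≤ A e^{−(1−θ)(log 2)|t|}` — the zero-momentum correlators decay at every rate below `log 2`
(`RobustBall.su2_wilson_timeslice_correlator_decay_upTo_oneTwelfth`). -/
def T73b_SU2WilsonTimesliceDecay : Prop :=
  ∀ βW : ℝ, 0 ≤ βW → βW ≤ 1 / 12 →
    ∀ μ ∈ ymGibbsMeasures (d := 4) (fundamentalRep (Fin 2)) (βW / 2),
    ∀ (F₁ F₂ : LGConfig 4 (Matrix.specialUnitaryGroup (Fin 2) ℂ) → ℝ),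
      Literature.MathematicalPhysics.QuantumLattice.IsLocalObservable F₁ →
      Literature.MathematicalPhysics.QuantumLattice.IsLocalObservable F₂ → Measurable F₁ → Measurable F₂ →
      (∃ C, ∀ U, |F₁ U| ≤ C) → (∃ C, ∀ U, |F₂ U| ≤ C) → ∀ θ : ℝ, 0 < θ → θ < 1 →
      ∃ A : ℝ, 0 ≤ A ∧ ∀ (i : Fin 4) (t : ℤ),
        Summable (fun x : {x : Site 4 // x i = t} => |cov[F₁, fun U => F₂ (configShift (x : Site 4) U); μ]|) ∧
        |∑' x : {x : Site 4 // x i = t}, cov[F₁, fun U => F₂ (configShift (x : Site 4) U); μ]| ≤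
          A * Real.exp (-((1 - θ) * Real.log 2) * |t|)

/-- T73b_SU2WilsonTimesliceDecay holds. -/
theorem T73b_SU2WilsonTimesliceDecay_holds : T73b_SU2WilsonTimesliceDecay :=
  fun _ h0 h _ hμ F₁ F₂ h₁ h₂ h₁m h₂m hb₁ hb₂ _ hθ0 hθ1 =>
    su2_wilson_timeslice_correlator_decay_upTo_oneTwelfth h0 h hμ F₁ F₂ h₁ h₂ h₁m h₂m hb₁ hb₂ hθ0 hθ1

/-- **T73c_ThermodynamicVariance — GENERIC**: for every `d`, every translation-invariant probability measure `μ` on the `ℤ^d` link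
configurations of any measurable group and every bounded measurable `f` whose autocovariance `v ↦ cov_μ(f, f∘θ_v)` is absolutely
summable: `Var_μ(Σ_{x∈B_n} f∘θ_x)/#B_n → Σ_v cov_μ(f, f∘θ_v)` (`B_n = siteBox d n`) and the limit is `≥ 0`
(`ThermodynamicVariance.tendsto_variance_boxSum_div`, `tsum_covariance_shift_nonneg`). -/
def T73c_ThermodynamicVariance : Prop :=
  ∀ (d : ℕ) (G : Type) [MeasurableSpace G] (μ : Measure (LGConfig d G)) [IsProbabilityMeasure μ],
    IsZdTranslationInvariant μ → ∀ (f : LGConfig d G → ℝ), Measurable f → ∀ M : ℝ, (∀ U, |f U| ≤ M) →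
    Summable (fun v : Site d => |cov[f, fun U => f (configShift v U); μ]|) →
      Tendsto (fun n : ℕ => Var[fun U => ∑ x ∈ siteBox d n, f (configShift x U); μ] / (siteBox d n).card) atTop
        (𝓝 (∑' v, cov[f, fun U => f (configShift v U); μ])) ∧
      0 ≤ ∑' v, cov[f, fun U => f (configShift v U); μ]

/-- T73c_ThermodynamicVariance holds. -/
theorem T73c_ThermodynamicVariance_holds : T73c_ThermodynamicVariance :=
  fun _ _ _ _ _ hμ _ hfm _ hfb hsum =>
    ⟨ThermodynamicVariance.tendsto_variance_boxSum_div hμ hfm hfb hsum,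
      ThermodynamicVariance.tsum_covariance_shift_nonneg hμ hfm hfb hsum⟩

/-- **T73d_SU2VarianceDensityIsSusceptibility — `SU(2)` ON `ℤ⁴`, `|b| ≤ 9/50`** (tree coupling; `|β_W| ≤ 9/25`, the vertex-star window):
the DLR states form a singleton `{μ}` and for EVERY bounded measurable gauge-invariant local observable `F` the autocovariance is
absolutely summable and `Var_μ(Σ_{x∈B_n} F∘θ_x)/#B_n → Σ_v cov_μ(F, F∘θ_v)`
(`ThermodynamicVariance.su2_wilson_tendsto_variance_boxSum_div`). -/
def T73d_SU2VarianceDensityIsSusceptibility : Prop :=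
  ∀ b : ℝ, |b| ≤ 9 / 50 →
    ∃ μ : Measure (LGConfig 4 (Matrix.specialUnitaryGroup (Fin 2) ℂ)),
      ymGibbsMeasures (d := 4) (fundamentalRep (Fin 2)) b = {μ} ∧
      ∀ F : LGConfig 4 (Matrix.specialUnitaryGroup (Fin 2) ℂ) → ℝ,
        Literature.MathematicalPhysics.QuantumLattice.IsLocalObservable F → Measurable F → (∃ C, ∀ U, |F U| ≤ C) →
        IsZdGaugeInvariant F →
          Summable (fun v : Site 4 => |cov[F, fun U => F (configShift v U); μ]|) ∧
          Tendsto (fun n : ℕ => Var[fun U => ∑ x ∈ siteBox 4 n, F (configShift x U); μ] / (siteBox 4 n).card) atTop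
            (𝓝 (∑' v, cov[F, fun U => F (configShift v U); μ]))

/-- T73d_SU2VarianceDensityIsSusceptibility holds. -/
theorem T73d_SU2VarianceDensityIsSusceptibility_holds : T73d_SU2VarianceDensityIsSusceptibility :=
  fun _ hb => ThermodynamicVariance.su2_wilson_tendsto_variance_boxSum_div hb

/-- **T73e_ErgodicCubeAverages — GENERIC, `d ≥ 2`**: for every translation-invariant probability measure `μ` on the `ℤ^d` link
configurations and every bounded measurable `f` with absolutely summable autocovariance: `#B_n⁻¹ Σ_{x∈B_n} f(θ_x U) → ∫ f dμ` for
`μ`-almost every `U` (`ErgodicAverages.ae_tendsto_boxAverage`). -/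
def T73e_ErgodicCubeAverages : Prop :=
  ∀ (d : ℕ), 2 ≤ d → ∀ (G : Type) [MeasurableSpace G] (μ : Measure (LGConfig d G)) [IsProbabilityMeasure μ],
    IsZdTranslationInvariant μ → ∀ (f : LGConfig d G → ℝ), Measurable f → ∀ M : ℝ, (∀ U, |f U| ≤ M) →
    Summable (fun v : Site d => |cov[f, fun U => f (configShift v U); μ]|) →
      ∀ᵐ U ∂μ, Tendsto (fun n : ℕ => (∑ x ∈ siteBox d n, f (configShift x U)) / (siteBox d n).card) atTop
        (𝓝 (∫ U', f U' ∂μ))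

/-- T73e_ErgodicCubeAverages holds. -/
theorem T73e_ErgodicCubeAverages_holds : T73e_ErgodicCubeAverages :=
  fun _ hd _ _ _ _ hμ _ hfm _ hfb hsum => ErgodicAverages.ae_tendsto_boxAverage hd hμ hfm hfb hsum

/-- **T73f_SU2AlmostSureSelfAveraging — `SU(2)` ON `ℤ⁴`, `|b| ≤ 9/50`** (`|β_W| ≤ 9/25`): the DLR states form a singleton `{μ}` and
EVERY bounded measurable gauge-invariant local observable `F` is self-averaging almost surely along cubes:
`#B_n⁻¹ Σ_{x∈B_n} F(θ_x U) → ⟨F⟩_μ` for `μ`-a.e. `U`, with the Chebyshev rate `μ{|avg_B − ⟨F⟩| ≥ ε} ≤ C_F/(ε²#B)` on every finite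
nonempty region `B` (`ErgodicAverages.su2_wilson_ae_tendsto_boxAverage`). -/
def T73f_SU2AlmostSureSelfAveraging : Prop :=
  ∀ b : ℝ, |b| ≤ 9 / 50 →
    ∃ μ : Measure (LGConfig 4 (Matrix.specialUnitaryGroup (Fin 2) ℂ)),
      ymGibbsMeasures (d := 4) (fundamentalRep (Fin 2)) b = {μ} ∧
      ∀ F : LGConfig 4 (Matrix.specialUnitaryGroup (Fin 2) ℂ) → ℝ,
        Literature.MathematicalPhysics.QuantumLattice.IsLocalObservable F → Measurable F → (∃ C, ∀ U, |F U| ≤ C) →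
        IsZdGaugeInvariant F →
          (∀ᵐ U ∂μ, Tendsto (fun n : ℕ => (∑ x ∈ siteBox 4 n, F (configShift x U)) / (siteBox 4 n).card) atTop
            (𝓝 (∫ U', F U' ∂μ))) ∧
          ∃ C : ℝ, ∀ (B : Finset (Site 4)), B.Nonempty → ∀ ε : ℝ, 0 < ε →
            μ {U | ε ≤ |(∑ x ∈ B, F (configShift x U)) / B.card - ∫ U', F U' ∂μ|} ≤
              ENNReal.ofReal (C / (ε ^ 2 * B.card))

/-- T73f_SU2AlmostSureSelfAveraging holds. -/
theorem T73f_SU2AlmostSureSelfAveraging_holds : T73f_SU2AlmostSureSelfAveraging :=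
  fun _ hb => ErgodicAverages.su2_wilson_ae_tendsto_boxAverage hb

end V23D_ds3_TimesliceVariance

/-! ### OWNER FILE `owners/V1X-CONJUNCTS-ds1g11-A.lean` (sha16 ce7d0e3678902248) — section `V23D_ds1_HaarMoments` -/
section V23D_ds1_HaarMoments

/-!
# v1.x conjunct CANDIDATE texts for p3 (ds-1 g11, block A = the three files IN THE TREE at 15:50Z) — NOT a proposal. Numbering is p3's.
# Each `T_…` is a closed Prop and `T_…_holds` its proof (tree-checkable: all parents landed and built).
HONEST FRAMING: pure compact-group integration for `SU(2)` / `SU(3)` and exact `β = 0` lattice statements for `SU(N)` Wilson lattice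
gauge theory on `ℤ^d`; nothing about `β > 0`, the continuum or Clay. All HYPOTHESIS-FREE.
-/


open MeasureTheory Set
open Literature.MathematicalPhysics.QuantumLattice
open Literature.MathematicalPhysics.QuantumFieldTheory hiding ZdEdge Site


/-- HAAR-4 (`SU(2)`): `∫_{SU(2)} (Re tr U)⁴ dU = 2` and `∫_{SU(2)} (½ Re tr U)⁴ dU = 1/8` — the fourth moment of the `SU(2)`
character (Catalan `C₂`; Sato–Tate/semicircle law), and `∫ (Re tr U)³ dU = 0`. -/
def T74a_SU2HaarFourthMoment : Prop :=
  (∫ U, ((U : Matrix (Fin 2) (Fin 2) ℂ).trace.re) ^ 4 ∂haarProbability (Matrix.specialUnitaryGroup (Fin 2) ℂ) = 2) ∧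
  (∫ U, ((2 : ℝ)⁻¹ * (U : Matrix (Fin 2) (Fin 2) ℂ).trace.re) ^ 4 ∂haarProbability (Matrix.specialUnitaryGroup (Fin 2) ℂ) = 1 / 8) ∧
  (∫ U, ((U : Matrix (Fin 2) (Fin 2) ℂ).trace.re) ^ 3 ∂haarProbability (Matrix.specialUnitaryGroup (Fin 2) ℂ) = 0)

/-- Proof of `T74a_SU2HaarFourthMoment`. -/
theorem T74a_SU2HaarFourthMoment_holds : T74a_SU2HaarFourthMoment :=
  ⟨HaarFourthMoment.integral_reTr_pow_four_su2, HaarFourthMoment.integral_half_reTr_pow_four_su2,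
    HaarFourthMoment.integral_reTr_pow_three_su2⟩

/-- HAAR-3 (`SU(3)`): the baryon vertex normalisation `∫_{SU(3)} U₀₀ U₁₁ U₂₂ dU = 1/6` (Creutz (8.25)). -/
def T74b_SU3HaarBaryon : Prop :=
  ∫ U, (U : Matrix (Fin 3) (Fin 3) ℂ) 0 0 * (U : Matrix (Fin 3) (Fin 3) ℂ) 1 1 * (U : Matrix (Fin 3) (Fin 3) ℂ) 2 2
      ∂haarProbability (Matrix.specialUnitaryGroup (Fin 3) ℂ) = 1 / 6

/-- Proof of `T74b_SU3HaarBaryon`. -/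
theorem T74b_SU3HaarBaryon_holds : T74b_SU3HaarBaryon := by
  unfold T74b_SU3HaarBaryon
  have h := HaarThirdMomentSU3.integral_baryon (fundamentalRep (Fin 3)) (TorusAreaLaw.isSpecialUnitaryModel_fundamentalRep 3)
  simpa only [fundamentalRep_apply] using h

/-- LATTICE-COMBINATORICS (`ℤ^d`, every `d`): two DISTINCT plaquettes share at most one link, and a plaquette outside any set of at most
three plaquettes has a link lying in none of them. -/
def T74c_PlaquettesShareOneLink : Prop :=
  ∀ d : ℕ, (∀ p q : ZdPlaquette d, p ≠ q → (plaquetteEdges p ∩ plaquetteEdges q).card ≤ 1) ∧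
    ∀ (s : ZdPlaquette d) (T : Finset (ZdPlaquette d)), s ∉ T → T.card ≤ 3 →
      ∃ e ∈ plaquetteEdges s, ∀ t ∈ T, e ∉ plaquetteEdges t

/-- Proof of `T74c_PlaquettesShareOneLink`. -/
theorem T74c_PlaquettesShareOneLink_holds : T74c_PlaquettesShareOneLink :=
  fun _ => ⟨fun _ _ hpq => ZeroCouplingMoments.card_inter_plaquetteEdges_le_one hpq,
    fun s _ hs hT => ZeroCouplingMoments.exists_mem_plaquetteEdges_forall_not_mem s hs hT⟩

end V23D_ds1_HaarMoments

/-! ### DEFAULT GROUPING (p2): one consolidating conjunction per owner file — `G_<tag> := T_a ∧ T_b ∧ …` + `_holds`.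
The lead composes V23D by theme; p3 renames `G_<tag> ↦ T<k>_<Name>` (via --map) or regroups at will; these are additions, not owner bytes. -/
section V23D_groups

/-- Default group for section `V23D_ds3_TimesliceVariance`: the conjunction of its 6 owner texts. -/
def T73_TimesliceDecayAndFluctuations : Prop :=
  T73a_MassiveTimesliceDecay ∧ T73b_SU2WilsonTimesliceDecay ∧ T73c_ThermodynamicVariance ∧ T73d_SU2VarianceDensityIsSusceptibility ∧ T73e_ErgodicCubeAverages ∧ T73f_SU2AlmostSureSelfAveraging

/-- `T73_TimesliceDecayAndFluctuations` holds (componentwise by the owners' `_holds`). -/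
theorem T73_TimesliceDecayAndFluctuations_holds : T73_TimesliceDecayAndFluctuations :=
  ⟨T73a_MassiveTimesliceDecay_holds, T73b_SU2WilsonTimesliceDecay_holds, T73c_ThermodynamicVariance_holds, T73d_SU2VarianceDensityIsSusceptibility_holds, T73e_ErgodicCubeAverages_holds, T73f_SU2AlmostSureSelfAveraging_holds⟩

/-- Default group for section `V23D_ds1_HaarMoments`: the conjunction of its 3 owner texts. -/
def T74_HaarMomentsAndPlaquetteLinks : Prop :=
  T74a_SU2HaarFourthMoment ∧ T74b_SU3HaarBaryon ∧ T74c_PlaquettesShareOneLink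

/-- `T74_HaarMomentsAndPlaquetteLinks` holds (componentwise by the owners' `_holds`). -/
theorem T74_HaarMomentsAndPlaquetteLinks_holds : T74_HaarMomentsAndPlaquetteLinks :=
  ⟨T74a_SU2HaarFourthMoment_holds, T74b_SU3HaarBaryon_holds, T74c_PlaquettesShareOneLink_holds⟩

end V23D_groups

end Summit.Ventures.YMGap

end
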